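import Summits.QuantumAdvantage.QuantumAdvantage.Theorems.LocusDialGroupPointerBA

/-! # LocusDialGroupPointerB — part 2/2 (mechanical split for landing of `LocusDialGroupPointerB`; content verbatim; scopes re-opened with their variables) -/

set_option linter.dupNamespace false
noncomputable section
open scoped Classical

namespace Summit.QuantumAdvantage.QuantumAdvantage.Theorems.LocusDial
open Finset
open Literature.Computability.QuantumComplexity Literature.Computability.QuantumComplexity.RingHLF
open Summit.QuantumAdvantage.AdviceFreeQNC0
open Summit.QuantumAdvantage.QuantumAdvantage.Theorems.HolonomyDial (gCond)

section GroupHash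
variable {N : ℕ} {V : Type} [AddCommGroup V] [Fintype V] [DecidableEq V]

/-- fibre indicator by character orthogonality: `|V|·[h(x) = v] = Σ_ψ ψ(h(x) - v)`. -/
theorem gfibre_indicator (g : Fin N → V) (x : Fin N → Bool) (v : V) :
    (Fintype.card V : ℂ) * (if ghash g x = v then 1 else 0) = ∑ ψ : AddChar V ℂ, ψ (ghash g x - v) := by
  rw [AddChar.sum_apply_eq_ite (ghash g x - v)]
  by_cases h : ghash g x = v
  · rw [if_pos h, if_pos (sub_eq_zero.2 h), mul_one]
  · rw [if_neg h, if_neg (fun h0 => h (sub_eq_zero.1 h0)), mul_zero]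

/-- the fibre sum, expanded over the characters of `V`. -/
theorem gfibSum_expand (g : Fin N → V) (v : V) (a : ZMod 3) (k : ℕ) :
    (Fintype.card V : ℂ) * gfibSum g v a k = ∑ ψ : AddChar V ℂ,
      (∑ x ∈ (univ : Finset (Fin N → Bool)).filter (fun x => OddZeros x),
        (∏ i : Fin N, if x i = true then ψ (g i) else 1) *
          χ (a * (((Wk x k : ℕ) : ZMod 3) + ((Wk x (N - 1) : ℕ) : ZMod 3)))) *
      (ψ (-v) * χ (a * ((k + N : ℕ) : ZMod 3) - 2 * a)) := by
  unfold gfibSum gfib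
  rw [sum_filter, mul_sum]
  have hpt : ∀ x : Fin N → Bool, (Fintype.card V : ℂ) * (if ghash g x = v then χ (a * (kph x k - 2)) else 0) =
      ∑ ψ : AddChar V ℂ, ((∏ i : Fin N, if x i = true then ψ (g i) else 1) *
          χ (a * (((Wk x k : ℕ) : ZMod 3) + ((Wk x (N - 1) : ℕ) : ZMod 3)))) *
        (ψ (-v) * χ (a * ((k + N : ℕ) : ZMod 3) - 2 * a)) := by
    intro x
    have e : (if ghash g x = v then χ (a * (kph x k - 2)) else 0) =
        (if ghash g x = v then (1 : ℂ) else 0) * χ (a * (kph x k - 2)) := by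
      split_ifs <;> simp
    rw [e, ← mul_assoc, gfibre_indicator, sum_mul]
    apply sum_congr rfl
    intro ψ _
    rw [sub_eq_add_neg, AddChar.map_add_eq_mul, ψ_ghash, kph_expand, χ_add]
    have e2 : χ (a * ((k + N : ℕ) : ZMod 3) - 2 * a) = χ (a * ((k + N : ℕ) : ZMod 3) - 2 * a) := rfl
    ring
  simp_rw [hpt]
  rw [sum_comm]
  apply sum_congr rfl
  intro ψ _
  rw [sum_mul]

/-- **group-fibre bound**: `16·|V|·|gfibSum| ≤ 2^N` (`a ≠ 0`, `|V| ≤ 2^s`, `24 s + 98 ≤ N`). -/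
theorem gfibSum_bound (g : Fin N → V) (v : V) {a : ZMod 3} (ha : a ≠ 0) (k s : ℕ)
    (hV : Fintype.card V ≤ 2 ^ s) (hN : 24 * s + 98 ≤ N) :
    (16 : ℝ) * Fintype.card V * ‖gfibSum g v a k‖ ≤ 2 ^ N := by
  have hexp := gfibSum_expand g v a k
  set I : AddChar V ℂ → ℂ := fun ψ => ∑ x ∈ (univ : Finset (Fin N → Bool)).filter (fun x => OddZeros x),
        (∏ i : Fin N, if x i = true then ψ (g i) else 1) *
          χ (a * (((Wk x k : ℕ) : ZMod 3) + ((Wk x (N - 1) : ℕ) : ZMod 3))) with hI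
  have hnorm : (Fintype.card V : ℝ) * ‖gfibSum g v a k‖ ≤ ∑ ψ : AddChar V ℂ, ‖I ψ‖ := by
    have h3 : ‖(Fintype.card V : ℂ) * gfibSum g v a k‖ = (Fintype.card V : ℝ) * ‖gfibSum g v a k‖ := by
      rw [norm_mul, Complex.norm_natCast]
    rw [← h3, hexp]
    refine (norm_sum_le _ _).trans ?_
    apply sum_le_sum
    intro ψ _
    rw [norm_mul, norm_mul, norm_χ, AddChar.norm_apply, mul_one, mul_one]
  have hper : ∀ ψ : AddChar V ℂ, (16 : ℝ) * Fintype.card V * ‖I ψ‖ ≤ 2 ^ N :=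
    fun ψ => norm_gAppSum_le (fun i => ψ (g i)) (fun i => ψ_normSq ψ (g i)) ha k (Fintype.card V) s hV hN
  have hsum := sum_le_sum (fun ψ (_ : ψ ∈ (univ : Finset (AddChar V ℂ))) => hper ψ)
  rw [← mul_sum, sum_const, card_univ, AddChar.card_eq, nsmul_eq_mul] at hsum
  have hVpos : (0 : ℝ) < Fintype.card V := by exact_mod_cast Fintype.card_pos
  nlinarith [hnorm, hsum, norm_nonneg (gfibSum g v a k)]

/-- **the group-hash pointer loss law at fixed size**: if `|V| ≤ 2^s` and `24 s + 98 ≤ n`, a pointer that is ANY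
function `π` of the group hash `h_g(x) = Σ_{x_i=1} g_i` hits the kernel on at most `3/4` of the odd class. -/
theorem groupHashPointer_loss (n s : ℕ) (hN : 24 * s + 98 ≤ n) (hV : Fintype.card V ≤ 2 ^ s)
    (g : Fin n → V) (π : V → Fin n) :
    ((univ.filter fun x : Fin n → Bool => OddZeros x ∧ gCond x (π (ghash g x)).val).card : ℝ) ≤
      3 / 4 * (2 : ℝ) ^ (n - 1) := by
  -- the sets
  set Odd := (univ : Finset (Fin n → Bool)).filter (fun x => OddZeros x) with hOdd
  set G : (Fin n → Bool) → Prop := fun x => gCond x (π (ghash g x)).val with hG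
  set L := Odd.filter (fun x => kph x (π (ghash g x)).val = 2) with hL
  have hW : (univ.filter fun x : Fin n → Bool => OddZeros x ∧ gCond x (π (ghash g x)).val) = Odd.filter G := by
    rw [hOdd, filter_filter]
  have hLG : L = Odd.filter (fun x => ¬ G x) := by
    rw [hL]
    apply filter_congr
    intro x _
    rw [hG]
    simp only [gCond_iff_kph, not_not]
  have hWL : (Odd.filter G).card + L.card = Odd.card := by
    rw [hLG]
    exact card_filter_add_card_filter_not _
  have hOdd_le : Odd.card ≤ 2 ^ (n - 1) := HolonomyDial.card_odd_le (by omega)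
  have hOdd_ge : 2 ^ (n - 1) ≤ Odd.card := AnchorDial.card_odd_ge (by omega)
  -- fibres
  have hOdd_fib : Odd.card = ∑ v : V, (gfib g v).card := by
    rw [card_eq_sum_card_fiberwise (f := fun x => ghash g x) (t := (univ : Finset V)) (fun x _ => mem_univ _)]
    rfl
  have hL_fib : L.card = ∑ v : V, ((gfib g v).filter (fun x => kph x (π v).val = 2)).card := by
    rw [card_eq_sum_card_fiberwise (f := fun x => ghash g x) (t := (univ : Finset V)) (fun x _ => mem_univ _)]
    apply sum_congr rfl
    intro v _
    congr 1
    rw [hL]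
    unfold gfib
    ext x
    simp only [hOdd, mem_filter, mem_univ, true_and]
    constructor
    · rintro ⟨⟨hx, hk⟩, hv⟩
      exact ⟨⟨hx, hv⟩, by rw [← hv]; exact hk⟩
    · rintro ⟨⟨hx, hv⟩, hk⟩
      exact ⟨⟨hx, by rw [hv]; exact hk⟩, hv⟩
  have hVpos : (0 : ℝ) < Fintype.card V := by exact_mod_cast Fintype.card_pos
  have hfib : ∀ v : V, ((gfib g v).card : ℝ) ≤
      3 * ((gfib g v).filter (fun x => kph x (π v).val = 2)).card + 2 ^ n / (8 * Fintype.card V) := by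
    intro v
    have h0 := set_count_le (gfib g v) (π v).val
    have h1 := gfibSum_bound g v (show (1 : ZMod 3) ≠ 0 by decide) (π v).val s hV hN
    have h2 := gfibSum_bound g v (show (2 : ZMod 3) ≠ 0 by decide) (π v).val s hV hN
    have hb1 : ‖gfibSum g v 1 (π v).val‖ ≤ 2 ^ n / (16 * Fintype.card V) := by
      rw [le_div_iff₀ (by positivity)]; linarith
    have hb2 : ‖gfibSum g v 2 (π v).val‖ ≤ 2 ^ n / (16 * Fintype.card V) := by
      rw [le_div_iff₀ (by positivity)]; linarith
    have e : (2 : ℝ) ^ n / (16 * Fintype.card V) + 2 ^ n / (16 * Fintype.card V) =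
        2 ^ n / (8 * Fintype.card V) := by
      field_simp; ring
    unfold gfibSum at hb1 hb2
    linarith
  have hmain : (Odd.card : ℝ) ≤ 3 * L.card + 2 ^ n / 8 := by
    rw [hOdd_fib, hL_fib]
    push_cast
    have hs := sum_le_sum (fun v (_ : v ∈ (univ : Finset V)) => hfib v)
    rw [sum_add_distrib, sum_const, card_univ, nsmul_eq_mul, ← mul_sum] at hs
    have e : (Fintype.card V : ℝ) * (2 ^ n / (8 * Fintype.card V)) = 2 ^ n / 8 := by
      field_simp
    linarith
  -- the count
  rw [hW]
  have hWr : ((Odd.filter G).card : ℝ) = Odd.card - L.card := by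
    have := congrArg (fun m : ℕ => (m : ℝ)) hWL
    push_cast at this
    linarith
  have hOl : (Odd.card : ℝ) ≤ 2 ^ (n - 1) := by exact_mod_cast hOdd_le
  have hOg : (2 : ℝ) ^ (n - 1) ≤ Odd.card := by exact_mod_cast hOdd_ge
  have hpow : (2 : ℝ) ^ n = 2 * 2 ^ (n - 1) := by
    rw [← pow_succ']; congr 1; omega
  rw [hWr]
  linarith

/-- **`GroupHashPointerLoss3`** — the GROUP-HASH POINTER LOSS LAW: for every finite abelian group `V` with
`|V| ≤ 2^s`, `s ≤ (log₂ n)^c`, every `g : Fin n → V` and every table `π : V → Fin n`, the pointer `π(Σ_{x_i=1} g_i)`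
hits the kernel on at most a `1 - 1/n^C` fraction of the odd class.  Covers: `𝔽₃`-linear hashes (`V = 𝔽₃^t`,
`AffinePointerLoss3`), SUBSET PARITIES (`V = 𝔽₂^s`, outside low `𝔽₃`-degree), Hamming weight mod `m`, and mixtures. -/
def GroupHashPointerLoss3 : Prop :=
  ∃ C : ℕ, ∀ c : ℕ, ∃ n₀ : ℕ, ∀ n ≥ n₀, ∀ s : ℕ, s ≤ (Nat.log 2 n) ^ c →
    ∀ (V : Type) [AddCommGroup V] [Fintype V] [DecidableEq V], Fintype.card V ≤ 2 ^ s →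
      ∀ g : Fin n → V, ∀ π : V → Fin n,
        ((univ.filter fun x : Fin n → Bool => OddZeros x ∧ gCond x (π (ghash g x)).val).card : ℝ) ≤
          (1 - 1 / (n : ℝ) ^ C) * (2 : ℝ) ^ (n - 1)

end GroupHash

/-- **`GroupHashPointerLoss3` PROVED** (`C = 1`). -/
theorem groupHashPointerLoss3 : GroupHashPointerLoss3 := by
  refine ⟨1, fun c => ?_⟩
  obtain ⟨n₁, hn₁⟩ := TubePlanProof.logPow_le_natSqrt c
  refine ⟨max n₁ 4096, fun n hn s hs V _ _ _ hV g π => ?_⟩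
  have hn1 : n₁ ≤ n := le_trans (le_max_left _ _) hn
  have h4096 : 4096 ≤ n := le_trans (le_max_right _ _) hn
  have hsq : (Nat.log 2 n) ^ c ≤ Nat.sqrt n := hn₁ n hn1
  have hs64 : 64 ≤ Nat.sqrt n := Nat.le_sqrt.2 (by omega)
  have hss : Nat.sqrt n * Nat.sqrt n ≤ n := Nat.sqrt_le n
  have hsN : 24 * s + 98 ≤ n := by nlinarith [hs, hsq, hs64, hss]
  have h := groupHashPointer_loss n s hsN hV g π
  have hn4 : (4 : ℝ) ≤ n := by exact_mod_cast h4096.trans' (by norm_num)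
  have h1n : 1 / (n : ℝ) ^ 1 ≤ 1 / 4 := by
    rw [pow_one]; exact one_div_le_one_div_of_le (by norm_num) hn4
  have hpos : (0 : ℝ) ≤ 2 ^ (n - 1) := by positivity
  have hrhs : (3 / 4 : ℝ) * 2 ^ (n - 1) ≤ (1 - 1 / (n : ℝ) ^ 1) * 2 ^ (n - 1) :=
    mul_le_mul_of_nonneg_right (by linarith) hpos
  linarith

/-! ## §J  Corollary: SUBSET-PARITY pointers (`V = 𝔽₂^s`) -/

section Parity
variable {N s : ℕ}

/-- the subset-parity hash: coordinate `j` is the parity of the number of ones of `x` inside `S_j`. -/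
def parityHash (S : Fin s → Fin N → Bool) (x : Fin N → Bool) : Fin s → ZMod 2 :=
  fun j => ((univ.filter fun i : Fin N => x i = true ∧ S j i = true).card : ZMod 2)

/-- LocusDialGroupPointerB helper `parityHash_eq_ghash` (decomp-qadv land package; see the module docstring). -/
theorem parityHash_eq_ghash (S : Fin s → Fin N → Bool) (x : Fin N → Bool) :
    parityHash S x = ghash (fun i => fun j => if S j i = true then (1 : ZMod 2) else 0) x := by
  funext j
  unfold parityHash ghash
  rw [Finset.sum_apply, card_eq_sum_ones, sum_filter]
  push_cast
  apply sum_congr rfl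
  intro i _
  by_cases hx : x i = true
  · by_cases hS : S j i = true
    · simp [hx, hS]
    · simp [hx, hS]
  · simp [hx]

/-- **`ParityPointerLoss3`**: a pointer that is ANY function of ANY `s ≤ (log₂ n)^c` SUBSET PARITIES of the input
(a class outside low `𝔽₃`-degree) hits the kernel on at most a `1 - 1/n^C` fraction of the odd class. -/
def ParityPointerLoss3 : Prop :=
  ∃ C : ℕ, ∀ c : ℕ, ∃ n₀ : ℕ, ∀ n ≥ n₀, ∀ s : ℕ, s ≤ (Nat.log 2 n) ^ c →
    ∀ S : Fin s → Fin n → Bool, ∀ π : (Fin s → ZMod 2) → Fin n,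
      ((univ.filter fun x : Fin n → Bool => OddZeros x ∧ gCond x (π (parityHash S x)).val).card : ℝ) ≤
        (1 - 1 / (n : ℝ) ^ C) * (2 : ℝ) ^ (n - 1)

/-- **`ParityPointerLoss3` PROVED** (from `groupHashPointerLoss3`, `V = Fin s → ZMod 2`). -/
theorem parityPointerLoss3 : ParityPointerLoss3 := by
  obtain ⟨C, hC⟩ := groupHashPointerLoss3
  refine ⟨C, fun c => ?_⟩
  obtain ⟨n₀, hn₀⟩ := hC c
  refine ⟨n₀, fun n hn s hs S π => ?_⟩
  have hV : Fintype.card (Fin s → ZMod 2) ≤ 2 ^ s := by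
    rw [Fintype.card_fun, ZMod.card, Fintype.card_fin]
  have h := hn₀ n hn s hs (Fin s → ZMod 2) hV (fun i => fun j => if S j i = true then (1 : ZMod 2) else 0) π
  have e : (univ.filter fun x : Fin n → Bool => OddZeros x ∧ gCond x (π (parityHash S x)).val) =
      (univ.filter fun x : Fin n → Bool => OddZeros x ∧
        gCond x (π (ghash (fun i => fun j => if S j i = true then (1 : ZMod 2) else 0) x)).val) := by
    apply filter_congr
    intro x _
    rw [parityHash_eq_ghash]
  rw [e]
  exact h

end Parity

/-! ## §K  Corollary: the group law dominates the affine law (`V = 𝔽₃^t`) -/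

section AffineFromGroup
variable {N t : ℕ}

/-- LocusDialGroupPointerB helper `linHash_eq_ghash` (decomp-qadv land package; see the module docstring). -/
theorem linHash_eq_ghash (M : Fin t → Fin N → ZMod 3) (x : Fin N → Bool) :
    linHash M x = ghash (fun i => fun s => M s i) x := by
  funext j
  unfold ghash
  rw [Finset.sum_apply]
  simp only [linHash]
  apply sum_congr rfl
  intro i _
  by_cases hx : x i = true
  · simp [hx]
  · simp [hx]

end AffineFromGroup

/-- `GroupHashPointerLoss3 → AffinePointerLoss3` (take `V = Fin t → ZMod 3`, `|V| = 3^t ≤ 2^{2t}`, `2t ≤ (log₂ n)^{c+1}`). -/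
theorem affinePointerLoss3_of_groupHash (h : GroupHashPointerLoss3) : AffinePointerLoss3 := by
  obtain ⟨C, hC⟩ := h
  refine ⟨C, fun c => ?_⟩
  obtain ⟨n₀, hn₀⟩ := hC (c + 1)
  refine ⟨max n₀ 4, fun n hn t ht M π => ?_⟩
  have hn0 : n₀ ≤ n := le_trans (le_max_left _ _) hn
  have hn4 : 4 ≤ n := le_trans (le_max_right _ _) hn
  have hlog : 2 ≤ Nat.log 2 n := by
    have : Nat.log 2 4 ≤ Nat.log 2 n := Nat.log_mono_right hn4
    have h4 : Nat.log 2 4 = 2 := by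
      rw [show (4 : ℕ) = 2 ^ 2 by norm_num, Nat.log_pow (by norm_num)]
    omega
  have hs : 2 * t ≤ (Nat.log 2 n) ^ (c + 1) := by
    rw [pow_succ]
    nlinarith [ht, Nat.zero_le ((Nat.log 2 n) ^ c)]
  have hV : Fintype.card (Fin t → ZMod 3) ≤ 2 ^ (2 * t) := by
    rw [Fintype.card_fun, ZMod.card, Fintype.card_fin, pow_mul]
    exact Nat.pow_le_pow_left (by norm_num) t
  have h := hn₀ n hn0 (2 * t) hs (Fin t → ZMod 3) hV (fun i => fun s => M s i) π
  have e : (univ.filter fun x : Fin n → Bool => OddZeros x ∧ gCond x (π (linHash M x)).val) =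
      (univ.filter fun x : Fin n → Bool => OddZeros x ∧
        gCond x (π (ghash (fun i => fun s => M s i) x)).val) := by
    apply filter_congr
    intro x _
    rw [linHash_eq_ghash]
  rw [e]
  exact h

end Summit.QuantumAdvantage.QuantumAdvantage.Theorems.LocusDial
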